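import Summits.NavierStokesRegularity.FluidComputer.TriggerClassSweepLedgerCDc

/-!
# Door N1-FC, the (host × Reynolds × seed-class) trigger sweep — ledger continuation of `TriggerClassSweepLedgerCD` (§11): the
# circuit seats' 384³ SECOND-ENGINE rows of the three WORDED cells on H(d) (raw and symmetrised) at ν₀/3, and the closing three-engine
# summary of the seven (c)/(d)/(b, generic) cells — beside the pen's cell words «C-0» = KILL (cited)

Cell `pub-fluidc` (FLUID COMPUTER; host summit `NavierStokesRegularity`, negation side, machine paradigm), seat
`pub-fluidc-dns-B3` (ENGINE B, r = 3; gen 2, 2026-08-27; D-0081 §A2 «FLUID-COMPUTER TRIGGER SWEEP», bears_on N1-FC, token FC-TRIG-3).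
HONEST FRAMING: low prior, high value-of-information experiment on Tao's machine paradigm; NOT a claim that NS blows up.
WHAT THIS IS NOT: not Navier–Stokes evidence and not a word — TYPED ARITHMETIC on the numbers PRINTED by the cell's registered THIRD integrator at
the DECIDING GRID 384³ (PREREG-FC-TRIG-3 `code/gadgets/PREREG-FC-TRIG-3.md`, frozen prefix 77 177 B sha256 f46874a3…; §3.4 / RULING (B-1) l.101 / l.104,
(B-1.2); circuit seats `ns-blowup-circuit3` (raw host d: C-0 j262089, cell #19 S j269225) and `ns-blowup-circuit2` (h_Σ(d): C-0 PROJECTED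
j266211, #20 T_e j266983, #21 T_o j267822), code-disjoint pseudo-spectral RK4 `main_c3.py` d72de2ee… / `main_c2.py` lineage). Sources = the custody
pen's MERGED RECORDS OF RECORD `code/gadgets/staging/fc-trig-3/reads/`: `records_d_r3_generic_of_record.json` 677b2569b5a90e2f… (12 rows), `records_d_r3_mirror_of_record.json`
b93001bf6ce2b9c0… (10 rows), `records_d_r3_odd_of_record.json` f2706d6380917c3c… (7 rows), each merge K-READ row by row against its sources and the
reader `fc3_words.py` v3 re-run byte-identically by `pub-fluidc-ref4` / `ns-blowup-refuter2` before the word was posted; the literals below are those files'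
7-decimal roundings. THE WORDS ARE THE PEN'S (prereg §6.1; cited, never claimed): l.149 SLOT 5 (xvi) = cell #19 «CELL BELOW, rescue ABSENT both seeds — «C-0» = KILL», l.142 SLOT 5 (xi) = cell #20
«CELL BELOW, rescue ABSENT both seeds — «C-0» = KILL», l.148 SLOT 5 (xv) = cell #21 «CELL BELOW, rescue ABSENT both seeds — «C-0» = KILL». With `TriggerClassSweepLedgerCDc` (§10: #13, #14, #15, #7)
every cell of `TriggerClassSweepLedgerCD` now carries its three integrators' rows typed side by side.

* §11 (`d`): THREE circuit 384³ X rows — #19 S ↔ CD row 23, #20 T_e ↔ row 27, #21 T_o ↔ row 33 — + `hostC0d` (d raw, dΣ): `threeEngine_agree_d`, `jump_eq_d`,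
  `absent_above_delta_d`, `sameClass_d`, `etaMinusD_le`, `certificate_standard_d`, `hostC0d_vs_engineA` (dΣ: the circuit's t 2.00 row = engine A's `etaHost 27`
  EXACTLY = CD `etaMinus 27 … 33`), `secondEngine_reads_bestCell_d`, per cell `cell19_/cell20_/cell21_threeEngines`, and the closing `cdCells_threeEngines_absent`:
  on all seven cells' pen-named seeds, engine A (both grids) · engine B (256³) · circuit (384³) every `|Λ|` is `≤ 0.0002945` and below a twentieth of
  `0.0053613`, the smallest floor typed in CD / CDb / CDc / here; floor-lemma instances on the circuit rows.
0 sorry; no named fact; no instance; axioms ⊆ {propext, Classical.choice, Quot.sound}.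
-/

noncomputable section

namespace Summit.NavierStokesRegularity.FluidComputer.TriggerClassSweepLedgerCD

open Summit.NavierStokesRegularity.FluidComputer.GadgetDetectionFloor
open Summit.NavierStokesRegularity.FluidComputer.TriggeredTransfer

/-! ## §11 APPEND `d` (dns-B3 gen 2, 2026-08-27): the circuit 384³ second-engine rows of the worded cells #19, #20, #21

Member order (cell; arm; circuit job ↔ engine-A 384³ row; peak row): 0: #19 (d, 3, generic) S circuit3 j269225 FROM FILE ↔ CD row 23 (interior, t_read
2.0808); 1: #20 (dΣ, 3, mirror) T_e circuit2 j266983 ↔ row 27 (first-row, t_read = t_inj = 2.00; C-0 PROJECTED); 2: #21 (dΣ, 3, odd) T_o circuit2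
j267822 ↔ row 33 (first-row, 2.0000). t_inj 2.00, ε = 0.1, τ 0. Each leg's C-0 = the circuit's OWN 384³ continuation of the variant from engine A's
t 2.00 bytes (`hostC0d`). -/

/-- `η_child` on the circuit (384³) per member (7-decimal roundings of the pen's merged records of record). -/
def etaChildD : Fin 3 → ℝ := ![0.2959482, 0.2940658, 0.2879022]
/-- `J` on the circuit per member (parity-exact `J = ε²` on #21 T_o). -/
def jumpD : Fin 3 → ℝ := ![0.0088261, 0.0161636, 0.0100000]
/-- The circuit's own `η_{C-0}` over the member's window at 384³ (d raw j262089; dΣ j266211, the t 2.00 row). -/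
def etaHostD : Fin 3 → ℝ := ![0.2871650, 0.2779022, 0.2779022]
/-- The circuit's floor `δ = max(0.02 η_child, |J − ε²|)` per member (cross-term branch on #20 T_e, as on every engine). -/
def deltaD : Fin 3 → ℝ := ![0.0059190, 0.0061636, 0.0057580]
/-- `η⁻ = η_child − J` on the circuit. -/
def etaMinusD (k : Fin 3) : ℝ := etaChildD k - jumpD k
/-- `Λ` on the circuit (its own C-0 row). -/
def lambdaMechD (k : Fin 3) : ℝ := (etaChildD k - etaHostD k) - jumpD k
/-- Engine A's 384³ rows matched by the members: CD rows 23 / 27 / 33. -/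
def rowOfD : Fin 3 → Fin 37 := ![23, 27, 33]

/-- THREE-ENGINE AGREEMENT at the deciding grid on H(d): `|η_child,C − η_child,A| ≤ 0.0000004` (≤ 1e-5 · η) on all three members, EXACT on the first-row Σ members. [folklore] -/
theorem threeEngine_agree_d : ∀ k : Fin 3, |etaChildD k - etaChild (rowOfD k)| ≤ 0.0000004 ∧ |etaChildD k - etaChild (rowOfD k)| ≤ 1e-5 * etaChild (rowOfD k) ∧
    |etaChildD k - etaChild (rowOfD k)| ≤ 0.05 * etaChild (rowOfD k) ∧ (k ≠ 0 → etaChildD k = etaChild (rowOfD k)) := by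
  intro k; fin_cases k <;> simp [etaChildD, etaChild, rowOfD] <;> norm_num [abs_le]

/-- Same seed bytes ⇒ `J` and `δ` are engine A's 7-decimal numbers on all three members (δ to 1e-7); the cross-term branch binds on #20 T_e (`δ = J − ε²`). [folklore] -/
theorem jump_eq_d : ∀ k : Fin 3, jumpD k = jump (rowOfD k) ∧ |deltaD k - delta (rowOfD k)| ≤ 1e-7 ∧ (k ≠ 1 → |deltaD k - 0.02 * etaChildD k| ≤ 1e-7) ∧
    (k = 1 → deltaD k = jumpD k - 0.01 ∧ 0.02 * etaChildD k < deltaD k) := by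
  intro k; fin_cases k <;> simp [jumpD, jump, deltaD, delta, etaChildD, rowOfD] <;> norm_num [abs_le]

/-- «mech ≤ δ» on the third integrator, H(d): `20 |Λ_C| < δ_C` on all three members; `|Λ_C| ≤ 0.0000429`; `Λ_C = 0` EXACTLY on the two first-row Σ members. [folklore] -/
theorem absent_above_delta_d : ∀ k : Fin 3, |lambdaMechD k| ≤ deltaD k ∧ 20 * |lambdaMechD k| < deltaD k ∧ |lambdaMechD k| ≤ 0.0000429 ∧ (k ≠ 0 → lambdaMechD k = 0) := by
  intro k; fin_cases k <;> simp [lambdaMechD, etaChildD, etaHostD, jumpD, deltaD] <;> norm_num [abs_le, abs_lt]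

/-- SAME CLASS on engine A and the circuit at 384³ on H(d): `|Λ_C − Λ_A| ≤ 0.0000001` (#19) / `0.0000001` (#20) / `0.0000001` (#21) — on h_Σ(d) BOTH integrators take the
t 2.00 row as the window value, so no sampling offset arises (contrast §9 / §10); each `Λ` inside both floors. [folklore] -/
theorem sameClass_d : ∀ k : Fin 3, |lambdaMechD k - lambdaMech (rowOfD k)| ≤ 0.0000001 ∧ |lambdaMech (rowOfD k)| ≤ deltaD k ∧ |lambdaMechD k| ≤ delta (rowOfD k) := by
  intro k; fin_cases k <;> simp [lambdaMechD, lambdaMech, etaChildD, etaHostD, jumpD, deltaD, etaChild, etaHost, jump, delta, rowOfD] <;> norm_num [abs_le]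

/-- The circuit's `η⁻` on H(d): within `0.0000004` of engine A's 384³ row; `≤ 0.3082`, hence `≤ 349/1000`, gap `≥ 0.165`. [folklore] -/
theorem etaMinusD_le : ∀ k : Fin 3, |etaMinusD k - etaMinus (rowOfD k)| ≤ 0.0000004 ∧ etaMinusD k ≤ 0.3082 ∧ etaMinusD k ≤ 349 / 1000 ∧ 0.165 ≤ 1 / 2 - etaMinusD k := by
  intro k; fin_cases k <;> simp [etaMinusD, etaMinus, etaChildD, jumpD, etaChild, jump, rowOfD] <;> norm_num [abs_le]

/-- Every circuit floor `δ ≤ 7/1000`. [folklore] -/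
theorem deltaD_le : ∀ k : Fin 3, deltaD k ≤ 7 / 1000 := by
  intro k; fin_cases k <;> simp [deltaD] <;> norm_num

/-- MEMBER BY MEMBER on the third integrator (`not_kelvin_two_of_reading`). [folklore] -/
theorem no_kelvin_two_of_rowD (k : Fin 3) {η : ℝ} (hread : |etaMinusD k - η| ≤ deltaD k) : ¬ 1 < η * 2 :=
  not_kelvin_two_of_reading hread (etaMinusD_le k).2.2.1 ((deltaD_le k).trans (by norm_num))

/-- … and no one-child `TriggerScheme` with `λ = 2` inside the circuit's certified window of any member. [cite: Tao2016AveragedNS, §1.3] -/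
theorem no_triggerScheme_two_of_rowD (k : Fin 3) :
    ¬ ∃ 𝒮 : TriggerScheme, 𝒮.lam = 2 ∧ |etaMinusD k - 𝒮.eta| ≤ deltaD k :=
  not_exists_triggerScheme_two_of_reading (etaMinusD_le k).2.2.1 ((deltaD_le k).trans (by norm_num))

/-- Resolution certificate `k_max·η_K` on the circuit at 384³ per member (3 decimals). -/
def certMinD : Fin 3 → ℝ := ![2.048, 2.067, 2.070]

/-- THE REGISTERED FINE STANDARD HOLDS on every member (`≥ 1.3`, indeed `≥ 2.0`), each within `0.02` of engine A's certificate on the matched row. [folklore] -/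
theorem certificate_standard_d : ∀ k : Fin 3, 1.3 ≤ certMinD k ∧ 2.0 ≤ certMinD k ∧ |certMinD k - certMin (rowOfD k)| ≤ 0.02 := by
  intro k; fin_cases k <;> simp [certMinD, certMin, rowOfD] <;> norm_num [abs_le]

/-- The circuit's untriggered 384³ window values on H(d): (d raw) circuit3 j262089 (interior maximum, t_read 2.0887), (dΣ) circuit2 j266211 PROJECTED, the
t 2.00 row (#20 / #21). -/
def hostC0d : Fin 2 → ℝ := ![0.2871650, 0.2779022]

/-- The members' C-0 rows ARE these two runs. [folklore] -/
theorem etaHostD_eq_hostC0d : etaHostD 0 = hostC0d 0 ∧ etaHostD 1 = hostC0d 1 ∧ etaHostD 2 = hostC0d 1 := by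
  simp [etaHostD, hostC0d]

/-- THREE INTEGRATORS, ONE HOST on H(d): the circuit's raw-d 384³ window maximum sits within `0.0000005` of engine A's `hostRawCD 3` (and engine B's 256³
`hostC0b 2` within 1.3e-6 of engine A's 256³ value, §9); on h_Σ(d) the circuit's t 2.00 row IS engine A's `etaHost 27 = 0.2779022` EXACTLY — the common first-row
reading `etaMinus 27 = … = etaMinus 33` of all five engine-A seeds (`dSigma_ties`) — `1.40e-5` above the 256³ value `hostC0b 3` (two-grid) and below the variant's
earlier peak `hostSigmaCD 3`. [folklore] -/
theorem hostC0d_vs_engineA :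
    (|hostC0d 0 - hostRawCD 3| ≤ 0.0000005 ∧ 0 ≤ hostC0d 0 - hostRawCD 3) ∧
    (hostC0d 1 = etaHost 27 ∧ hostC0d 1 = etaMinus 27 ∧ hostC0d 1 = etaMinus 33 ∧ hostC0d 1 - hostC0b 3 = 0.000014 ∧ hostC0d 1 < hostSigmaCD 3) := by
  refine ⟨?_, ?_⟩
  · simp [hostC0d, hostRawCD]; norm_num [abs_le]
  · simp [hostC0d, etaHost, etaMinus, etaChild, jump, hostC0b, hostSigmaCD]; norm_num

/-- Every circuit host window value on H(d) is `< 1/2` with gap `≥ 0.21`. [folklore] -/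
theorem hostC0d_gap : ∀ i : Fin 2, hostC0d i < 1 / 2 ∧ 0.21 ≤ 1 / 2 - hostC0d i := by
  intro i; fin_cases i <;> simp [hostC0d] <;> norm_num

/-- (B-1.2) AS ARITHMETIC on H(d): the pen-named seed re-read by the circuit at the deciding grid reproduces CD `bestCell 3 / 4 / 5` (#19 S, #20 T_e, #21 T_o) to
`≤ 0.0000004`. [folklore] -/
theorem secondEngine_reads_bestCell_d : |etaMinusD 0 - bestCell 3| ≤ 0.0000004 ∧ |etaMinusD 1 - bestCell 4| ≤ 0.0000004 ∧ |etaMinusD 2 - bestCell 5| ≤ 0.0000004 := by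
  simp [etaMinusD, etaChildD, jumpD, bestCell]; norm_num [abs_le]

/-- CELL #19 (d, 3, generic), seed S — word of record prereg l.149 SLOT 5 (xvi) «CELL BELOW, rescue ABSENT both seeds — «C-0» = KILL» (the pen's):
`η⁻` reads 0.2871157 (A 256³, row 20) · 0.2871148 (B 256³) · 0.2871217 (A 384³, row 23) · 0.2871221 (circuit 384³) — spread `≤ 0.0000073` across grids, `≤ 0.0000009`
between integrators at equal grid; `Λ` = -4.24e-05 · -4.20e-05 · -4.28e-05 · -4.29e-05, every one below a twentieth of the smallest of the four floors (0.0059188). [folklore] -/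
theorem cell19_threeEngines :
    (|etaMinus 20 - etaMinusB 4| ≤ 0.0000009 ∧ |etaMinus 23 - etaMinusD 0| ≤ 0.0000009 ∧ |etaMinus 23 - etaMinus 20| ≤ 0.0000073 ∧ |etaMinusD 0 - etaMinusB 4| ≤ 0.0000073) ∧
    (20 * |lambdaMech 20| < deltaD 0 ∧ 20 * |lambdaMechB 4| < deltaD 0 ∧ 20 * |lambdaMech 23| < deltaD 0 ∧ 20 * |lambdaMechD 0| < deltaD 0 ∧
      20 * |lambdaMech 20| < deltaB 4 ∧ 20 * |lambdaMechD 0| < deltaB 4 ∧ 20 * |lambdaMechD 0| < delta 20 ∧ 20 * |lambdaMechB 4| < delta 23) ∧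
    (etaMinus 23 < 0.45 ∧ etaMinusD 0 < 0.45 ∧ 0.165 ≤ 1 / 2 - etaMinusD 0) := by
  refine ⟨?_, ?_, ?_⟩ <;>
    simp [etaMinus, etaMinusB, etaMinusD, lambdaMech, lambdaMechB, lambdaMechD, etaChild, jump, etaHost, delta, etaChildB, jumpB, etaHostB, deltaB,
      etaChildD, jumpD, etaHostD, deltaD] <;> norm_num [abs_le, abs_lt]

/-- CELL #20 (dΣ, 3, mirror), seed T_e — word of record prereg l.142 SLOT 5 (xi) «CELL BELOW, rescue ABSENT both seeds — «C-0» = KILL» (the pen's):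
`η⁻` reads 0.2778882 (A 256³, row 24) · 0.2778882 (B 256³) · 0.2779022 (A 384³, row 27) · 0.2779022 (circuit 384³) — spread `≤ 0.0000140` across grids, `≤ 0.0000001`
between integrators at equal grid; `Λ` = +6.19e-05 · +0.00e+00 · +0.00e+00 · +0.00e+00, every one below a twentieth of the smallest of the four floors (0.0061636). [folklore] -/
theorem cell20_threeEngines :
    (|etaMinus 24 - etaMinusB 5| ≤ 0.0000001 ∧ |etaMinus 27 - etaMinusD 1| ≤ 0.0000001 ∧ |etaMinus 27 - etaMinus 24| ≤ 0.0000140 ∧ |etaMinusD 1 - etaMinusB 5| ≤ 0.0000140) ∧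
    (20 * |lambdaMech 24| < deltaD 1 ∧ 20 * |lambdaMechB 5| < deltaD 1 ∧ 20 * |lambdaMech 27| < deltaD 1 ∧ 20 * |lambdaMechD 1| < deltaD 1 ∧
      20 * |lambdaMech 24| < deltaB 5 ∧ 20 * |lambdaMechD 1| < deltaB 5 ∧ 20 * |lambdaMechD 1| < delta 24 ∧ 20 * |lambdaMechB 5| < delta 27) ∧
    (etaMinus 27 < 0.45 ∧ etaMinusD 1 < 0.45 ∧ 0.165 ≤ 1 / 2 - etaMinusD 1) := by
  refine ⟨?_, ?_, ?_⟩ <;>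
    simp [etaMinus, etaMinusB, etaMinusD, lambdaMech, lambdaMechB, lambdaMechD, etaChild, jump, etaHost, delta, etaChildB, jumpB, etaHostB, deltaB,
      etaChildD, jumpD, etaHostD, deltaD] <;> norm_num [abs_le, abs_lt]

/-- CELL #21 (dΣ, 3, odd), seed T_o — word of record prereg l.148 SLOT 5 (xv) «CELL BELOW, rescue ABSENT both seeds — «C-0» = KILL» (the pen's):
`η⁻` reads 0.2778882 (A 256³, row 31) · 0.2778882 (B 256³) · 0.2779022 (A 384³, row 33) · 0.2779022 (circuit 384³) — spread `≤ 0.0000140` across grids, `≤ 0.0000001`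
between integrators at equal grid; `Λ` = +6.19e-05 · +0.00e+00 · +0.00e+00 · +0.00e+00, every one below a twentieth of the smallest of the four floors (0.0057578). [folklore] -/
theorem cell21_threeEngines :
    (|etaMinus 31 - etaMinusB 6| ≤ 0.0000001 ∧ |etaMinus 33 - etaMinusD 2| ≤ 0.0000001 ∧ |etaMinus 33 - etaMinus 31| ≤ 0.0000140 ∧ |etaMinusD 2 - etaMinusB 6| ≤ 0.0000140) ∧
    (20 * |lambdaMech 31| < deltaD 2 ∧ 20 * |lambdaMechB 6| < deltaD 2 ∧ 20 * |lambdaMech 33| < deltaD 2 ∧ 20 * |lambdaMechD 2| < deltaD 2 ∧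
      20 * |lambdaMech 31| < deltaB 6 ∧ 20 * |lambdaMechD 2| < deltaB 6 ∧ 20 * |lambdaMechD 2| < delta 31 ∧ 20 * |lambdaMechB 6| < delta 33) ∧
    (etaMinus 33 < 0.45 ∧ etaMinusD 2 < 0.45 ∧ 0.165 ≤ 1 / 2 - etaMinusD 2) := by
  refine ⟨?_, ?_, ?_⟩ <;>
    simp [etaMinus, etaMinusB, etaMinusD, lambdaMech, lambdaMechB, lambdaMechD, etaChild, jump, etaHost, delta, etaChildB, jumpB, etaHostB, deltaB,
      etaChildD, jumpD, etaHostD, deltaD] <;> norm_num [abs_le, abs_lt]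

/-- THE SEVEN CELLS OF THIS LEDGER, THREE INTEGRATORS, TWO GRIDS — on every pen-named seed (#13 S, #14 S_e, #15 T_o, #19 S, #20 T_e, #21 T_o, #7 S) the mechanical excess
reads `|Λ| ≤ 0.0002945` on engine A at 256³ and 384³ (CD rows 3/6, 8/11, 14/16, 20/23, 24/27, 31/33, 34/36), on engine B at 256³ (§9 members) and on the circuit at 384³
(§10 members 0–3, §11 members): below an EIGHTEENTH of `0.0053160`, the smallest detection floor typed anywhere in CD / CDb / CDc / CDd (CD row 7, (cΣ, 3, mirror) T_e at 256³).
The words on these cells are the pen's (prereg l.124 / l.136 / l.138 / l.140 / l.149 / l.142 / l.148, quoted verbatim in §10 / §11); this is their arithmetic. [folklore] -/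
theorem cdCells_threeEngines_absent :
    (∀ i : Fin 14, |lambdaMech (![3, 6, 8, 11, 14, 16, 20, 23, 24, 27, 31, 33, 34, 36] i)| ≤ 0.0002945) ∧ (∀ k : Fin 8, |lambdaMechB k| ≤ 0.0002945) ∧
    (∀ k : Fin 4, |lambdaMechC (![0, 1, 2, 3] k)| ≤ 0.0002945) ∧ (∀ k : Fin 3, |lambdaMechD k| ≤ 0.0002945) ∧
    (18 * (0.0002945 : ℝ) < 0.0053160 ∧ (∀ i : Fin 37, 0.0053160 ≤ delta i) ∧ (∀ k : Fin 8, 0.0053160 ≤ deltaB k) ∧ (∀ k : Fin 5, 0.0053160 ≤ deltaC k) ∧ ∀ k : Fin 3, 0.0053160 ≤ deltaD k) := by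
  refine ⟨fun i => ?_, fun k => ?_, fun k => ?_, fun k => ?_, ⟨by norm_num, fun i => ?_, fun k => ?_, fun k => ?_, fun k => ?_⟩⟩
  · fin_cases i <;> simp [lambdaMech, etaChild, etaHost, jump] <;> norm_num [abs_le]
  · fin_cases k <;> simp [lambdaMechB, etaChildB, etaHostB, jumpB] <;> norm_num [abs_le]
  · fin_cases k <;> simp [lambdaMechC, etaChildC, etaHostC, jumpC] <;> norm_num [abs_le]
  · fin_cases k <;> simp [lambdaMechD, etaChildD, etaHostD, jumpD] <;> norm_num [abs_le]
  · fin_cases i <;> simp [delta] <;> norm_num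
  · fin_cases k <;> simp [deltaB] <;> norm_num
  · fin_cases k <;> simp [deltaC] <;> norm_num
  · fin_cases k <;> simp [deltaD] <;> norm_num

end Summit.NavierStokesRegularity.FluidComputer.TriggerClassSweepLedgerCD

end
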